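import Summits.BirchSwinnertonDyer.BirchSwinnertonDyer.Theorems.CyclotomicUntwistDescendedFrobeniusTransferSemantics
import Summits.BirchSwinnertonDyer.BirchSwinnertonDyer.Theorems.ResidualThetaTransportAtTwoRelativeLubinTateBase
import Literature.NumberTheory.EllipticCurves.FormalGroupMultiplicationUniversalProofs
import HarnessLib

/-!
# Route `CyclotomicUntwist`: the VERSCHIEBUNG side of the Berthelot–Ogus transfer — `[−9]_E ≡ ν(z⁹) (mod 3)` for
# every Weierstrass equation `E` over `𝓞 = 𝓞_{ℚ₃(ζ₉)}`, and `ν` is a homomorphism `V̂₀ → Ê` modulo `3` whenever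
# `E ≡ V₀ (mod ϖ)`, `3 ∣ ϖ⁶`

Cell `pub/bsd-wall` (D-0145 line `route-BirchSwinnertonDyer-CyclotomicUntwist`), prover seat `bsd-line-cycu-p2`
(gen 6), lane «D5»; sequel of `…DescendedFrobeniusTransferSemantics` (the Frobenius side `z ↦ z⁹ : Ê → V̂₀ (mod 3)`,
Katz 5.1.4). THEOREMS ONLY (no definition, no named fact, no `sorry`); helper `--supports` K1 =
stmt-BirchSwinnertonDyer-21580. BSD is not proved by this file and no crux is.

Berthelot–Ogus's comparison `D(Ê/𝓞)_ℚ ≅ D(V̂₀/ℤ₃)_ℚ ⊗ L` for a good model `E` of WILD potentially good reduction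
(`e = 6 > p − 1`) is, in Katz's explicit language, the pair of pointed maps `φ = z⁹ : Ê → V̂₀` and a lift `ν` of the
second Verschiebung `V² : V̂₀ = Ê^{(9)} → Ê` — both homomorphisms MODULO THE DIVIDED-POWER IDEAL `(3)` (not merely
modulo `ϖ`), with `φ ∘ ν ≡ ν ∘ φ ≡ [∓9]`. This file constructs `ν` and proves the two congruences it must satisfy:
* `exists_verschiebung_lift`: for EVERY `E/𝓞` there is `ν ∈ 𝓞⟦z⟧`, `ν(0) = 0`, with **`[−9]_E(z) ≡ ν(z⁹) (mod 3)`**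
  (over `𝓞/3`, of characteristic `3`: `[3] = g(z³)` (AEC IV.4.4), `[9] = g(g(z³)³) = g(g^{(3)}(z⁹))`, `[−9] = i([9])`;
  the canonical lift `ν = Σⱼ [z^{9j}][−9]_E zʲ`).
* `map_pow_nine_formalGroupLaw_eq`: `Ĝ⁹ ≡ G₀(X⁹,Y⁹) (mod 3)` (the Frobenius side, restated in `(𝓞/3)⟦X,Y⟧`).
* **`verschiebung_hom_mod_three`**: if `E ≡ V₀ ⊗ 𝓞 (mod ϖ)` with `3 ∣ ϖ⁶` then **`ν(G₀(X,Y)) ≡ Ĝ(ν(X), ν(Y)) (mod 3)`** —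
  `ν` is a homomorphism `V̂₀ ⊗ (𝓞/3) → Ê ⊗ (𝓞/3)`; proof: both sides agree after `(X,Y) ↦ (X⁹,Y⁹)` because `[−9]_E` is an
  endomorphism of `Ĝ` (`RelativeLubinTate.formalNeg_subst_formalMul_subst_formalGroupLaw'`, every ring), and
  `(X,Y) ↦ (X⁹,Y⁹)` is injective on `(𝓞/3)⟦X,Y⟧`.
Hence (Katz 5.1.4 with `I = (3)`) `f ↦ f ∘ ν` maps `D(Ê/𝓞)_ℚ → D(V̂₀ ⊗ 𝓞/𝓞)_ℚ` and `(f ∘ ν)(z⁹) ≡ f([−9] z) ≡ −9·f` —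
the surjectivity half of the transfer (sequel file).
[cite: Katz1981CrystallineDieudonne, §5 Thm 5.1.4] [cite: BerthelotOgus1983, Thm. 2.4 (proof)] [cite: SilvermanAEC2009, IV.4.4]
-/

set_option autoImplicit false
-- single-conjunct summit: `Summit.BirchSwinnertonDyer.BirchSwinnertonDyer.…` repeats the name by design
set_option linter.dupNamespace false

noncomputable section

open PowerSeries Literature.RingTheory.FormalGroups Literature.NumberTheory.EllipticCurves
  Literature.NumberTheory.EllipticCurves.DescendedFrobenius

namespace Summit.BirchSwinnertonDyer.BirchSwinnertonDyer.Theorems.DescendedFrobeniusTransfer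

/-! ## §1 Reduction modulo `3`: `(𝓞/3)⟦σ⟧`, characteristic `3` -/

/-- `𝓞/3𝓞` has characteristic `3` (`3` is not a unit of `𝓞`). [folklore] -/
theorem charP_ONine_mod_three : CharP (ONine ⧸ Ideal.span {(3 : ONine)}) 3 := by
  have h := CharP.quotient ONine 3 (by exact_mod_cast three_not_isUnit_ONine)
  rw [Nat.cast_ofNat] at h
  exact h

/-- Two `𝓞`-series agree in `(𝓞/3)⟦σ⟧` iff they are congruent modulo `3` coefficientwise. [folklore] -/
theorem map_mk_eq_map_mk_iff {σ : Type*} (F F' : MvPowerSeries σ ONine) :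
    MvPowerSeries.map (Ideal.Quotient.mk (Ideal.span {(3 : ONine)})) F =
      MvPowerSeries.map (Ideal.Quotient.mk (Ideal.span {(3 : ONine)})) F' ↔
    ∀ d, (3 : ONine) ∣ MvPowerSeries.coeff d (F - F') := by
  rw [MvPowerSeries.ext_iff]
  refine forall_congr' fun d ↦ ?_
  rw [MvPowerSeries.coeff_map, MvPowerSeries.coeff_map, Ideal.Quotient.eq, Ideal.mem_span_singleton, map_sub]

/-- `C c ∣ F` iff `c` divides every coefficient of `F` (any commutative ring). [folklore] -/
theorem C_dvd_iff_forall_dvd_coeff {σ : Type*} {S : Type*} [CommRing S] (c : S) (F : MvPowerSeries σ S) :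
    MvPowerSeries.C c ∣ F ↔ ∀ d, c ∣ MvPowerSeries.coeff d F := by
  constructor
  · rintro ⟨w, rfl⟩ d
    rw [MvPowerSeries.coeff_C_mul]; exact dvd_mul_right c _
  · intro h
    choose w hw using h
    exact ⟨fun d ↦ w d, MvPowerSeries.ext fun d ↦ by rw [MvPowerSeries.coeff_C_mul]; exact hw d⟩

/-- `expand` is injective on several-variable series (any commutative ring): `[X^{p·d}] F(X^p) = [X^d] F`. [folklore] -/
theorem mvExpand_injective {σ : Type*} {S : Type*} [CommRing S] (p : ℕ) (hp : p ≠ 0) {F F' : MvPowerSeries σ S}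
    (h : MvPowerSeries.expand p hp F = MvPowerSeries.expand p hp F') : F = F' := by
  ext d
  have := congrArg (MvPowerSeries.coeff (p • d)) h
  rwa [MvPowerSeries.coeff_expand_smul, MvPowerSeries.coeff_expand_smul] at this

/-- `expand 3 ∘ expand 3 = expand 9` on one-variable series (any commutative ring). [folklore] -/
theorem expand_three_expand_three {S : Type*} [CommRing S] (w : S⟦X⟧) :
    PowerSeries.expand 3 (by norm_num) (PowerSeries.expand 3 (by norm_num) w) = PowerSeries.expand 9 (by norm_num) w := by
  rw [PowerSeries.expand_apply, PowerSeries.expand_apply, PowerSeries.expand_apply,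
    PowerSeries.subst_comp_subst_apply (PowerSeries.HasSubst.X_pow (by norm_num)) (PowerSeries.HasSubst.X_pow (by norm_num)),
    PowerSeries.subst_pow (PowerSeries.HasSubst.X_pow (by norm_num)), PowerSeries.subst_X (PowerSeries.HasSubst.X_pow (by norm_num)),
    ← pow_mul]

/-- `(expand 3 g) ∘ h = g ∘ h³` (any commutative ring, `h(0) = 0`). [folklore] -/
theorem expand_three_subst {S : Type*} [CommRing S] (g : S⟦X⟧) {h : S⟦X⟧} (hh : PowerSeries.constantCoeff h = 0) :
    (PowerSeries.expand 3 (by norm_num) g).subst h = g.subst (h ^ 3) := by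
  have hs : PowerSeries.HasSubst h := PowerSeries.HasSubst.of_constantCoeff_zero' hh
  rw [PowerSeries.expand_apply, PowerSeries.subst_comp_subst_apply (PowerSeries.HasSubst.X_pow (by norm_num)) hs,
    PowerSeries.subst_pow hs, PowerSeries.subst_X hs]

/-! ## §2 The Verschiebung lift: `[−9]_E ≡ ν(z⁹) (mod 3)` -/

/-- **Over a ring of characteristic `3`, `[9](z) = w(z⁹)`** with `w = g ∘ g^{(3)}`, `g` the series of AEC IV.4.4
(`[3] = g(z³)`), `g^{(3)}` = `g` with coefficients cubed. [cite: SilvermanAEC2009, IV.4.4] -/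
theorem formalMul_nine_eq_expand_of_charP {S : Type*} [CommRing S] [CharP S 3] (V : WeierstrassCurve S) :
    V.formalMul 9 = PowerSeries.expand 9 (by norm_num)
      ((V.formalMulFrobPart 3).subst (PowerSeries.map (frobenius S 3) (V.formalMulFrobPart 3))) := by
  haveI : Fact (Nat.Prime 3) := ⟨Nat.prime_three⟩
  haveI : ExpChar S 3 := ExpChar.prime Nat.prime_three
  set g := V.formalMulFrobPart 3 with hg
  have hg0 : PowerSeries.constantCoeff g = 0 := V.constantCoeff_formalMulFrobPart 3
  have hgf0 : PowerSeries.constantCoeff (PowerSeries.map (frobenius S 3) g) = 0 := by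
    rw [← PowerSeries.coeff_zero_eq_constantCoeff_apply, PowerSeries.coeff_map,
      PowerSeries.coeff_zero_eq_constantCoeff_apply, hg0, map_zero]
  have h3 : V.formalMul 3 = PowerSeries.expand 3 (by norm_num) g := V.formalMul_prime_eq_expand_of_charP 3
  -- `g³ = (g^{(3)})(z³)` (Frobenius of `S⟦z⟧`)
  have hfrob : g ^ 3 = PowerSeries.expand 3 (by norm_num) (PowerSeries.map (frobenius S 3) g) := by
    rw [← PowerSeries.map_expand]
    exact (MvPowerSeries.map_frobenius_expand 3 (by norm_num) (f := g)).symm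
  have key : (V.formalMul 3).subst (V.formalMul 3) =
      PowerSeries.expand 3 (by norm_num) (PowerSeries.expand 3 (by norm_num)
        (g.subst (PowerSeries.map (frobenius S 3) g))) := by
    rw [h3, WeierstrassCurve.subst_expand_eq_expand_subst 3 _ _ hg0, expand_three_subst g hg0, hfrob,
      WeierstrassCurve.subst_expand_eq_expand_subst 3 _ _ hgf0]
  rw [V.formalMul_mul_subst' 3 3, expand_three_expand_three] at key
  exact key

/-- **`[−9]_E ≡ ν(z⁹) (mod 3)` — a lift `ν ∈ 𝓞⟦z⟧`, `ν(0) = 0`, of the second Verschiebung, for EVERY Weierstrass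
equation `E` over `𝓞`.** Over `𝓞/3`: `[−9] = i([9]) = i(w(z⁹)) = (i ∘ w)(z⁹)`; the canonical lift
`ν := Σⱼ [z^{9j}] [−9]_E · zʲ` reduces to `i ∘ w`. [cite: Katz1981CrystallineDieudonne, §5 Thm 5.1.4]
[cite: SilvermanAEC2009, IV.4.4] -/
theorem exists_verschiebung_lift (E : WeierstrassCurve ONine) :
    ∃ ν : ONine⟦X⟧, PowerSeries.constantCoeff ν = 0 ∧
      PowerSeries.map (Ideal.Quotient.mk (Ideal.span {(3 : ONine)})) (E.formalNeg.subst (E.formalMul 9)) =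
        PowerSeries.map (Ideal.Quotient.mk (Ideal.span {(3 : ONine)})) (PowerSeries.expand 9 (by norm_num) ν) := by
  set π : ONine →+* ONine ⧸ Ideal.span {(3 : ONine)} := Ideal.Quotient.mk _ with hπ
  haveI : CharP (ONine ⧸ Ideal.span {(3 : ONine)}) 3 := charP_ONine_mod_three
  set Eb := E.map π with hEb
  set w := (Eb.formalMulFrobPart 3).subst (PowerSeries.map (frobenius _ 3) (Eb.formalMulFrobPart 3)) with hw
  have hw0 : PowerSeries.constantCoeff w = 0 :=
    PowerSeries.constantCoeff_subst_eq_zero (by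
      change PowerSeries.constantCoeff (PowerSeries.map _ (Eb.formalMulFrobPart 3)) = 0
      rw [← PowerSeries.coeff_zero_eq_constantCoeff_apply, PowerSeries.coeff_map,
        PowerSeries.coeff_zero_eq_constantCoeff_apply, Eb.constantCoeff_formalMulFrobPart, map_zero]) _
      (Eb.constantCoeff_formalMulFrobPart 3)
  -- `[−9]` over `𝓞/3` is `(i ∘ w)(z⁹)`
  have hred : PowerSeries.map π (E.formalNeg.subst (E.formalMul 9)) =
      PowerSeries.expand 9 (by norm_num) (Eb.formalNeg.subst w) := by
    rw [WeierstrassCurve.powerSeries_map_subst _ (E.hasSubst_formalMul 9), WeierstrassCurve.map_formalNeg,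
      WeierstrassCurve.map_formalMul, formalMul_nine_eq_expand_of_charP,
      WeierstrassCurve.subst_expand_eq_expand_subst 9 _ _ hw0]
  set μ := E.formalNeg.subst (E.formalMul 9) with hμ
  refine ⟨PowerSeries.mk fun j ↦ PowerSeries.coeff (9 * j) μ, ?_, ?_⟩
  · rw [← PowerSeries.coeff_zero_eq_constantCoeff_apply, PowerSeries.coeff_mk, mul_zero,
      PowerSeries.coeff_zero_eq_constantCoeff_apply]
    exact Summit.BirchSwinnertonDyer.BirchSwinnertonDyer.Theorems.RelativeLubinTate.constantCoeff_formalNeg_subst_formalMul' E 9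
  · rw [hred, PowerSeries.map_expand]
    congr 1
    ext j
    rw [PowerSeries.coeff_map, PowerSeries.coeff_mk, ← PowerSeries.coeff_map, hred, PowerSeries.coeff_expand_mul]

/-! ## §3 The Frobenius side in `(𝓞/3)⟦X,Y⟧`: `Ĝ⁹ = G₀(X⁹,Y⁹)` -/

/-- **`Ĝ⁹ ≡ G₀(X⁹, Y⁹) (mod 3)`** as an equality over `𝓞/3`, for `E ≡ V₀ ⊗ 𝓞 (mod ϖ)`, `3 ∣ ϖ⁶`.
[cite: BerthelotOgus1983, Thm. 2.4 (proof)] -/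
theorem map_pow_nine_formalGroupLaw_eq {ϖ : ONine} (hϖ : (3 : ONine) ∣ ϖ ^ 6) {E : WeierstrassCurve ONine}
    {V₀ : WeierstrassCurve ℤ_[3]}
    (hEV : E.map (Ideal.Quotient.mk (Ideal.span {ϖ})) =
      (V₀.map (algebraMap ℤ_[3] ONine)).map (Ideal.Quotient.mk (Ideal.span {ϖ}))) :
    MvPowerSeries.map (Ideal.Quotient.mk (Ideal.span {(3 : ONine)})) (E.formalGroupLaw ^ 9) =
      MvPowerSeries.map (Ideal.Quotient.mk (Ideal.span {(3 : ONine)}))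
        (MvPowerSeries.expand 9 (by norm_num) (V₀.map (algebraMap ℤ_[3] ONine)).formalGroupLaw) := by
  rw [map_mk_eq_map_mk_iff]
  refine three_dvd_coeff_pow_nine_sub_expand fun e ↦ ?_
  have h1 := formalGroupLaw_congr_mod hEV e
  have h2 : MvPowerSeries.coeff e (V₀.map (algebraMap ℤ_[3] ONine)).formalGroupLaw =
      algebraMap ℤ_[3] ONine (MvPowerSeries.coeff e V₀.formalGroupLaw) := by
    rw [← WeierstrassCurve.map_formalGroupLaw, MvPowerSeries.coeff_map]
  rw [h2] at h1 ⊢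
  exact pow_nine_sub_dvd hϖ h1

/-! ## §4 `ν` is a homomorphism `V̂₀ → Ê` modulo `3` -/

/-- **THE VERSCHIEBUNG LIFT IS A HOMOMORPHISM MODULO `3`.** For `E ≡ V₀ ⊗ 𝓞 (mod ϖ)` (`3 ∣ ϖ⁶`) and any `ν ∈ 𝓞⟦z⟧`,
`ν(0) = 0`, with `[−9]_E ≡ ν(z⁹) (mod 3)`: **`ν(G₀(X,Y)) ≡ Ĝ(ν(X), ν(Y)) (mod 3𝓞⟦X,Y⟧)`**. Proof in `(𝓞/3)⟦X,Y⟧`: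
`ν(G₀)(X⁹,Y⁹) = ν(G₀(X⁹,Y⁹)) = ν(Ĝ⁹) = [−9](Ĝ) = Ĝ([−9]X, [−9]Y) = Ĝ(ν(X⁹), ν(Y⁹)) = Ĝ(ν X, ν Y)(X⁹,Y⁹)`, and
`(X,Y) ↦ (X⁹,Y⁹)` is injective. This is the hypothesis of Katz's Theorem 5.1.4 for the pointed map `ν : V̂₀ → Ê` and the
divided-power ideal `(3) ⊂ 𝓞`. [cite: Katz1981CrystallineDieudonne, §5 Thm 5.1.4] [cite: BerthelotOgus1983, Thm. 2.4 (proof)] -/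
theorem verschiebung_hom_mod_three {ϖ : ONine} (hϖ : (3 : ONine) ∣ ϖ ^ 6) {E : WeierstrassCurve ONine}
    {V₀ : WeierstrassCurve ℤ_[3]}
    (hEV : E.map (Ideal.Quotient.mk (Ideal.span {ϖ})) =
      (V₀.map (algebraMap ℤ_[3] ONine)).map (Ideal.Quotient.mk (Ideal.span {ϖ})))
    {ν : ONine⟦X⟧} (hν0 : PowerSeries.constantCoeff ν = 0)
    (hν : PowerSeries.map (Ideal.Quotient.mk (Ideal.span {(3 : ONine)})) (E.formalNeg.subst (E.formalMul 9)) =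
      PowerSeries.map (Ideal.Quotient.mk (Ideal.span {(3 : ONine)})) (PowerSeries.expand 9 (by norm_num) ν)) :
    MvPowerSeries.map (Ideal.Quotient.mk (Ideal.span {(3 : ONine)}))
        (ν.subst (V₀.map (algebraMap ℤ_[3] ONine)).formalGroupLaw) =
      MvPowerSeries.map (Ideal.Quotient.mk (Ideal.span {(3 : ONine)}))
        (MvPowerSeries.subst (fun i : Fin 2 ↦ ν.subst (MvPowerSeries.X i : MvPowerSeries (Fin 2) ONine))
          E.formalGroupLaw) := by
  set π : ONine →+* ONine ⧸ Ideal.span {(3 : ONine)} := Ideal.Quotient.mk _ with hπ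
  set Eb := E.map π with hEb
  set G := E.formalGroupLaw with hG
  set G₀ := (V₀.map (algebraMap ℤ_[3] ONine)).formalGroupLaw with hG₀
  set νb := PowerSeries.map π ν with hνb
  have hG0c : MvPowerSeries.constantCoeff G = 0 := E.constantCoeff_formalGroupLaw
  have hG₀0c : MvPowerSeries.constantCoeff G₀ = 0 := WeierstrassCurve.constantCoeff_formalGroupLaw _
  have hGb : MvPowerSeries.map π G = Eb.formalGroupLaw := by rw [hG, WeierstrassCurve.map_formalGroupLaw]
  have hGb0c : MvPowerSeries.constantCoeff (MvPowerSeries.map π G) = 0 := by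
    rw [MvPowerSeries.constantCoeff_map, hG0c, map_zero]
  have hG₀b0c : MvPowerSeries.constantCoeff (MvPowerSeries.map π G₀) = 0 := by
    rw [MvPowerSeries.constantCoeff_map, hG₀0c, map_zero]
  have hνb0 : PowerSeries.constantCoeff νb = 0 := by
    rw [hνb, ← PowerSeries.coeff_zero_eq_constantCoeff_apply, PowerSeries.coeff_map,
      PowerSeries.coeff_zero_eq_constantCoeff_apply, hν0, map_zero]
  have hX0 : ∀ i : Fin 2, MvPowerSeries.constantCoeff (MvPowerSeries.X i : MvPowerSeries (Fin 2) (ONine ⧸ Ideal.span {(3 : ONine)})) = 0 :=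
    fun i ↦ MvPowerSeries.constantCoeff_X i
  -- `[−9]` over `𝓞/3` is `νb(z⁹)`
  have hμb : Eb.formalNeg.subst (Eb.formalMul 9) = PowerSeries.expand 9 (by norm_num) νb := by
    rw [hEb, ← WeierstrassCurve.map_formalNeg, ← WeierstrassCurve.map_formalMul,
      ← WeierstrassCurve.powerSeries_map_subst _ (E.hasSubst_formalMul 9), hν, PowerSeries.map_expand]
  -- `Ĝ⁹ = G₀(X⁹,Y⁹)` over `𝓞/3`
  have h9 : (MvPowerSeries.map π G) ^ 9 = MvPowerSeries.expand 9 (by norm_num) (MvPowerSeries.map π G₀) := by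
    rw [← map_pow, ← MvPowerSeries.map_expand]
    exact map_pow_nine_formalGroupLaw_eq hϖ hEV
  -- push `map π` through the substitutions
  have hνX : ∀ i : Fin 2, MvPowerSeries.HasSubst (fun i : Fin 2 ↦ ν.subst (MvPowerSeries.X i : MvPowerSeries (Fin 2) ONine)) :=
    fun _ ↦ MvPowerSeries.hasSubst_of_constantCoeff_zero fun i ↦
      PowerSeries.constantCoeff_subst_eq_zero (MvPowerSeries.constantCoeff_X i) _ hν0
  have hνbX : MvPowerSeries.HasSubst (fun i : Fin 2 ↦ νb.subst
      (MvPowerSeries.X i : MvPowerSeries (Fin 2) (ONine ⧸ Ideal.span {(3 : ONine)}))) :=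
    MvPowerSeries.hasSubst_of_constantCoeff_zero fun i ↦ PowerSeries.constantCoeff_subst_eq_zero (hX0 i) _ hνb0
  rw [PowerSeries.map_subst (PowerSeries.HasSubst.of_constantCoeff_zero hG₀0c), MvPowerSeries.map_subst (hνX 0)]
  have hfun : (fun i : Fin 2 ↦ MvPowerSeries.map π (ν.subst (MvPowerSeries.X i : MvPowerSeries (Fin 2) ONine))) =
      fun i : Fin 2 ↦ νb.subst (MvPowerSeries.X i : MvPowerSeries (Fin 2) (ONine ⧸ Ideal.span {(3 : ONine)})) := by
    funext i
    rw [PowerSeries.map_subst (PowerSeries.HasSubst.X i), MvPowerSeries.map_X]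
  rw [hfun]
  change νb.subst (MvPowerSeries.map π G₀) = MvPowerSeries.subst _ (MvPowerSeries.map π G)
  -- compare after `(X,Y) ↦ (X⁹,Y⁹)`
  refine mvExpand_injective 9 (by norm_num) ?_
  -- LHS: `νb(G₀)(X⁹,Y⁹) = νb(Ĝ⁹) = (expand 9 νb)(Ĝ) = [−9](Ĝ)`
  rw [← subst_expand_nine hG₀b0c, ← h9, ← expand_nine_subst hGb0c, ← hμb, hGb,
    Summit.BirchSwinnertonDyer.BirchSwinnertonDyer.Theorems.RelativeLubinTate.formalNeg_subst_formalMul_subst_formalGroupLaw'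
      Eb 9, hμb, MvPowerSeries.expand_subst _ _ hνbX]
  congr 1
  funext i
  rw [expand_nine_subst (hX0 i), ← MvPowerSeries.expand_X 9 (by norm_num) i, subst_expand_nine (hX0 i)]

end Summit.BirchSwinnertonDyer.BirchSwinnertonDyer.Theorems.DescendedFrobeniusTransfer
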